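import Literature.AnabelianGeometry.EtaleTheta.Discharge.Sec4GaloisLiftBTemp
import Literature.AnabelianGeometry.EtaleTheta.Discharge.Sec4BaseEquivOfTemperoids
import Literature.AnabelianGeometry.EtaleTheta.LogDivisorTower

/-!
# [EtTh] Prop. 4.2 (iii): the lift of coverings `hLift` — hence A10 `BaseRootLaw` from E2 (a) — for EVERY full,
# essentially surjective base functor `D ⥤ B^temp(Π)⁰` (print's `D = D₀[𝒟] → D₀`), and at the v2 tower datum

S. Mochizuki, *The étale theta function …*, Publ. RIMS **45** (2009) [MochizukiEtTh2009], §3 Def. 3.3 (iii) p.73, §4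
Def. 4.1 (ii) p.87, Prop. 4.2 (iii) p.89; S. Mochizuki, *Semi-graphs of anabelioids* (2006) [MochizukiSemiAnbd2006], Rmk.
3.1.3 p.34 [cite: MochizukiEtTh2009, Prop 4.2 (iii) p.89].  abc-iut cell, layer L2; seat abc-iut-L2-t3 (gen 5; E2 / A10
owner).  PROOF-ONLY (0 defs), nothing landed is edited.

abc-iut-L2-t3's `TemperedFrobenioid.baseRootLaw_of_rootLaw` (p449939) derives the §4 binder `hR₀ = BaseRootLaw IG`
from E2 (a) on the Def. 3.3 (iii) DATA (`DivisorMonoids.RootLaw`) and ONE categorical input, the lift `hLift` of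
coverings along the base functor `tf.base : D ⥤ D₀`; `Sec4GaloisLiftBTemp` (p452431) proved `hLift` for the IDENTITY
base of `D₀ = B^temp(Π)⁰`.  Print's base category of a tempered Frobenioid is `D = D₀[𝒟]` (§3 p.75: `D₀` glued with a
slim `𝒟`), whose projection `D → D₀` is FULL and (essentially) SURJECTIVE ON OBJECTS — not the identity.  This file
removes that gap:
* `ConnectedPart.hLift_top_of_full_essSurj` — `hLift` with `IG := ⊤` for every full, essentially surjective
  `F : D ⥤ B^temp(Π)⁰` (no temperedness needed);
* `ConnectedPart.hLift_galois_of_full_essSurj` — `hLift` with `IG X := «F X is Galois»` (Def. 4.1 (ii)) for every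
  such `F`, `Π` tempered (Galois domination `Sec4GaloisLiftBTemp` + iso-invariance of Galois objects);
* **`TemperedFrobenioid.baseRootLaw_galois_of_rootLaw_of_full_essSurj` / `baseRootLaw_top_of_rootLaw_…`** — for
  EVERY Def. 3.3 (iii) datum `dm` over `B^temp(Π)⁰` and every tempered Frobenioid over `ofRlfZWeak dm hpf` whose base
  functor is full and essentially surjective: `dm.RootLaw → tf.BaseRootLaw IG` (IG = Galois, resp. `⊤`);
* `TemperedFrobenioid.baseRootLaw_galois_ofTower_of_rootLaw` — the same AT THE v2 TOWER DATUM `DivisorMonoids.ofTower T`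
  (p455437): the kernel target of record of abc-iut-plan C-R34 (3) («`RootLaw (ofTower T)` + hLift ⟹ `BaseRootLaw`»)
  as ONE theorem by name, modulo only E2 (a) on the tower (its NV instance is abc-iut-w6-d058's «Tate tower v2»).
HONEST FRAMING: implications between OUR typed predicates; no instance of `RootLaw` with non-trivial `B₀` is claimed;
typed ≠ proved; nothing here bears on the disputed [IUTchIII] Cor. 3.12.
-/

noncomputable section

namespace Literature.AnabelianGeometry.EtaleTheta

open CategoryTheory Opposite Literature.AlgebraicGeometry.Frobenioids Literature.AlgebraicGeometry.Frobenioids.QuasiTemperoid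
  Literature.AnabelianGeometry.SemiGraphs Literature.AnabelianGeometry.SemiGraphs.GaloisObjects

universe u₀ v₀ u w

/-! ### §1 The lift of coverings along a full, essentially surjective base functor -/

section Lift

variable {G : Type u} [Group G] [TopologicalSpace G] {D : Type u₀} [Category.{v₀} D]
  (F : D ⥤ ConnectedPart (BTemp G)) [F.Full] [F.EssSurj]

/-- **`hLift` with `IG := ⊤` along a full, essentially surjective base functor**: a covering `f : Y' → F X` is
dominated by `F X'` with `F X' ≅ Y'` (`X'` an `F`-preimage of `Y'`), and `F X' ≅ Y' → F X` is `F c` by fullness.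
[cite: MochizukiEtTh2009, Prop 4.2 (iii) p.89] -/
theorem ConnectedPart.hLift_top_of_full_essSurj :
    ∀ (X : D), True → ∀ (Y' : ConnectedPart (BTemp G)) (f : Y' ⟶ F.obj X),
      ∃ (X' : D) (_ : True) (c : X' ⟶ X) (g : F.obj X' ⟶ Y'), g ≫ f = F.map c := fun _ _ Y' f =>
  ⟨F.objPreimage Y', trivial, F.preimage ((F.objObjPreimageIso Y').hom ≫ f), (F.objObjPreimageIso Y').hom,
    (F.map_preimage _).symm⟩

variable [IsTopologicalGroup G]

/-- **`hLift` with `IG := «Galois»` along a full, essentially surjective base functor** (`Π` tempered): dominate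
`Y'` by a Galois object `X₀ → Y'` ([SemiAnbd] Rmk. 3.1.3, `Sec4GaloisLiftBTemp`), pick an `F`-preimage `X'` of `X₀`
(`F X' ≅ X₀` is again Galois), and realise `F X' ≅ X₀ → Y' → F X` as `F c` by fullness.
[cite: MochizukiEtTh2009, Prop 4.2 (iii) p.89] -/
theorem ConnectedPart.hLift_galois_of_full_essSurj (hG : IsTempered G) :
    ∀ (X : D), IsGaloisObj (F.obj X).obj → ∀ (Y' : ConnectedPart (BTemp G)) (f : Y' ⟶ F.obj X),
      ∃ (X' : D) (_ : IsGaloisObj (F.obj X').obj) (c : X' ⟶ X) (g : F.obj X' ⟶ Y'), g ≫ f = F.map c := by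
  intro X _ Y' f
  obtain ⟨X₀, hX₀, ⟨g₀⟩⟩ := ConnectedPart.exists_hom_from_isGaloisObj hG Y'
  refine ⟨F.objPreimage X₀, ?_, F.preimage ((F.objObjPreimageIso X₀).hom ≫ g₀ ≫ f),
    (F.objObjPreimageIso X₀).hom ≫ g₀, ?_⟩
  · exact GaloisObjects.isGaloisObj_of_iso hG ((connectedObjects (BTemp G)).ι.mapIso (F.objObjPreimageIso X₀)) hX₀
  · rw [F.map_preimage, Category.assoc]

end Lift

/-! ### §2 A10 `BaseRootLaw` from E2 (a) on the data, for every full essentially surjective base -/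

namespace TemperedFrobenioid

variable {G : Type u} [Group G] [TopologicalSpace G]
  {dm : DivisorMonoids.{u + 1, u, w} (ConnectedPart (BTemp G))}
  {hpf : ∀ Y : (ConnectedPart (BTemp G))ᵒᵖ, IsPerfFactorialCof (dm.Φ₀.obj Y)}
  {D : Type u₀} [Category.{v₀} D] {VD : FrdICatStub.{u₀, v₀, w} D}
  (tf : TemperedFrobenioid (RealifiedDivisorMonoids.ofRlfZWeak dm hpf) D VD) [tf.base.Full] [tf.base.EssSurj]

/-- **A10 with `IG := ⊤` from E2 (a) on the data**, for every tempered Frobenioid over type-`ℤ` Def. 3.6 (i) data on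
`B^temp(Π)⁰` whose base functor is full and essentially surjective. [cite: MochizukiEtTh2009, Prop 4.2 (iii) p.89] -/
theorem baseRootLaw_top_of_rootLaw_of_full_essSurj (hR : dm.RootLaw) : tf.BaseRootLaw fun _ => True :=
  tf.baseRootLaw_of_rootLaw hR _ (ConnectedPart.hLift_top_of_full_essSurj tf.base)

variable [IsTopologicalGroup G]

/-- **A10 with `IG := «Galois»` (Def. 4.1 (ii)) from E2 (a) on the data** (`Π` tempered), for every tempered
Frobenioid over type-`ℤ` Def. 3.6 (i) data on `B^temp(Π)⁰` whose base functor is full and essentially surjective —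
print's `D = D₀[𝒟] → D₀`. [cite: MochizukiEtTh2009, Prop 4.2 (iii) p.89] -/
theorem baseRootLaw_galois_of_rootLaw_of_full_essSurj (hG : IsTempered G) (hR : dm.RootLaw) :
    tf.BaseRootLaw fun X => IsGaloisObj (tf.base.obj X).obj :=
  tf.baseRootLaw_of_rootLaw hR _ (ConnectedPart.hLift_galois_of_full_essSurj tf.base hG)

end TemperedFrobenioid

/-! ### §3 At the v2 tower datum `DivisorMonoids.ofTower T` -/

namespace TemperedFrobenioid

variable {P : Type u} [Group P] [TopologicalSpace P] [IsTopologicalGroup P] {L : LevelSystem P}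
  (T : LogDivisorTower P L)
  {hpf : ∀ Y : (ConnectedPart (BTemp P))ᵒᵖ, IsPerfFactorialCof ((DivisorMonoids.ofTower T).Φ₀.obj Y)}
  {D : Type u₀} [Category.{v₀} D] {VD : FrdICatStub.{u₀, v₀, u} D}
  (tf : TemperedFrobenioid (RealifiedDivisorMonoids.ofRlfZWeak (DivisorMonoids.ofTower T) hpf) D VD)
  [tf.base.Full] [tf.base.EssSurj]

/-- **Kernel target of record (abc-iut-plan C-R34 (3)) as one theorem by name**: at the v2 covering-indexed datum
`ofTower T` ([EtTh] Def. 3.3 (iii)), E2 (a) `RootLaw (ofTower T)` implies the §4 binder A10 `BaseRootLaw «Galois»`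
for every tempered Frobenioid over it with full, essentially surjective base (`Π` tempered) — whence hR
(`rootLaw_of_baseRootLaw'`) and condition (d) (`Sec4CondDOfRootLaw`). [cite: MochizukiEtTh2009, Prop 4.2 (iii) p.89] -/
theorem baseRootLaw_galois_ofTower_of_rootLaw (hG : IsTempered P) (hR : (DivisorMonoids.ofTower T).RootLaw) :
    tf.BaseRootLaw fun X => IsGaloisObj (tf.base.obj X).obj :=
  tf.baseRootLaw_galois_of_rootLaw_of_full_essSurj hG hR

end TemperedFrobenioid

end Literature.AnabelianGeometry.EtaleTheta

end
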